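/- Free-seat work of LEAD seat `ym-line-cbag-p1` (prover-ym-line-cbag-p1-g22-0; own crux stmt-QuantumFields-22254 closed) on the
planner-of-record's LINE 7, route `GlueballBandRecursion`: stub 2 of the planner's BC3 birth skeleton for crux `OneGlueballBandLower`
(stmt-QuantumFields-27506; HOME/l7/bc/OneGlueballBandLower_birth.lean, sha16 b152a1e529a0b798). -/
import Summits.QuantumFields.YangMills.Theorems.GlueballBandRecursionOneGlueballBandLowerDefs

/-!
# Route `GlueballBandRecursion`, crux `OneGlueballBandLower` (stmt-QuantumFields-27506): stub 2 `stub_gaussianLatticeCount` — PROVED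

The Gaussian lattice count of the birth skeleton, exactly as typed there (objects `momSq`, `bandSum` from the Defs file):
for every `κ > 0` there are `c > 0` and `N₀` with `c·N^{3/2} ≤ bandSum κ N (m+2)` whenever `⌊N/4⌋ = m + 2`, `N ≥ N₀`.
Proof (route-independent, elementary): the `(⌊√N⌋+1)³ ≥ N^{3/2}` momenta of the cube `pᵢ ≤ ⌊√N⌋` have centred size
`|p̃|² ≤ 3⌊√N⌋² ≤ 3N`, so at `t = m + 2 ≤ N/4` each of their terms is `≥ exp(−κ·(N/4)·3N/N²) = exp(−3κ/4)`; all other terms are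
positive.  Constants: `c = exp(−3κ/4)`, `N₀ = 8`.

HONEST FRAMING.  This is the skeleton's cheap stub; stub 1 (`stub_bandThermalFloor`, the one-glueball band in thermal form) is the
crux's whole content and stays OPEN.  Neither the crux, nor the rung `ColdDoublingRecursionStrongCoupling`, nor the Yang–Mills
mass gap is proved by anything here.
-/

set_option autoImplicit false

noncomputable section

open Finset

namespace Summit.QuantumFields.YangMills.Theorems.GlueballBandRecursion.Band

/-- On the small cube `pᵢ ≤ s` the centred size is at most `3s²`. -/
theorem momSq_le_of_le {N s : ℕ} (p : Fin N × Fin N × Fin N)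
    (h1 : p.1.val ≤ s) (h2 : p.2.1.val ≤ s) (h3 : p.2.2.val ≤ s) : momSq N p ≤ 3 * s ^ 2 := by
  unfold momSq
  have a1 : min p.1.val (N - p.1.val) ^ 2 ≤ s ^ 2 :=
    Nat.pow_le_pow_left ((min_le_left _ _).trans h1) 2
  have a2 : min p.2.1.val (N - p.2.1.val) ^ 2 ≤ s ^ 2 :=
    Nat.pow_le_pow_left ((min_le_left _ _).trans h2) 2
  have a3 : min p.2.2.val (N - p.2.2.val) ^ 2 ≤ s ^ 2 :=
    Nat.pow_le_pow_left ((min_le_left _ _).trans h3) 2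
  omega

/-- **Stub 2 (the Gaussian lattice count at `t = ⌊N/4⌋`)**: for every `κ > 0`,
`exp(−3κ/4)·N^{3/2} ≤ Σ_{p ∈ (ℤ/N)³} exp(−κ ⌊N/4⌋ |p̃|²/N²)` for all `N ≥ 8` — the `(⌊√N⌋+1)³ ≥ N^{3/2}` momenta of the cube
`pᵢ ≤ ⌊√N⌋` have `|p̃|² ≤ 3N`, hence exponent `≤ κ·(N/4)·3N/N² = 3κ/4`. -/
theorem stub_gaussianLatticeCount :
    ∀ κ : ℝ, 0 < κ → ∃ c : ℝ, 0 < c ∧ ∃ N₀ : ℕ, ∀ (N m : ℕ), N / 4 = m + 2 → N₀ ≤ N →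
      c * Real.sqrt (N : ℝ) ^ 3 ≤ bandSum κ N (m + 2) := by
  intro κ hκ
  refine ⟨Real.exp (-(3 * κ / 4)), Real.exp_pos _, 8, fun N m hm hN => ?_⟩
  -- the side `s = ⌊√N⌋` of the small cube
  set s : ℕ := Nat.sqrt N with hs
  have hsN : s < N := Nat.sqrt_lt_self (by omega)
  have hs2 : s ^ 2 ≤ N := Nat.sqrt_le' N
  have hN1 : N < (s + 1) ^ 2 := Nat.lt_succ_sqrt' N
  set a : Fin N := ⟨s, hsN⟩ with ha
  set S : Finset (Fin N × Fin N × Fin N) := Finset.Iic a ×ˢ (Finset.Iic a ×ˢ Finset.Iic a) with hSdef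
  have hcard : S.card = (s + 1) ^ 3 := by
    rw [hSdef, Finset.card_product, Finset.card_product, Fin.card_Iic]
    ring
  -- each term on the cube is at least `exp(−3κ/4)`
  have ht4 : 4 * (m + 2) ≤ N := by omega
  have hNpos : (0 : ℝ) < N := by exact_mod_cast (show 0 < N by omega)
  have hterm : ∀ p ∈ S, Real.exp (-(3 * κ / 4)) ≤
      Real.exp (-(κ * ((m + 2 : ℕ) : ℝ) * (momSq N p : ℝ) / (N : ℝ) ^ 2)) := by
    intro p hp
    rw [hSdef, Finset.mem_product, Finset.mem_product, Finset.mem_Iic, Finset.mem_Iic, Finset.mem_Iic] at hp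
    obtain ⟨h1, h2, h3⟩ := hp
    have hq : momSq N p ≤ 3 * s ^ 2 :=
      momSq_le_of_le p (Fin.le_def.1 h1) (Fin.le_def.1 h2) (Fin.le_def.1 h3)
    have hq' : momSq N p ≤ 3 * N := hq.trans (Nat.mul_le_mul_left 3 hs2)
    have hqR : (momSq N p : ℝ) ≤ 3 * (N : ℝ) := by exact_mod_cast hq'
    have htR : ((m + 2 : ℕ) : ℝ) ≤ (N : ℝ) / 4 := by
      have h : ((4 * (m + 2) : ℕ) : ℝ) ≤ N := by exact_mod_cast ht4
      push_cast at h ⊢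
      linarith
    refine Real.exp_le_exp.2 ?_
    rw [neg_le_neg_iff, div_le_iff₀ (by positivity)]
    have hq0 : (0 : ℝ) ≤ (momSq N p : ℝ) := by positivity
    have ht0 : (0 : ℝ) ≤ ((m + 2 : ℕ) : ℝ) := by positivity
    calc κ * ((m + 2 : ℕ) : ℝ) * (momSq N p : ℝ) ≤ κ * ((N : ℝ) / 4) * (3 * (N : ℝ)) := by gcongr
      _ = 3 * κ / 4 * (N : ℝ) ^ 2 := by ring
  have hnonneg : ∀ p ∈ (Finset.univ : Finset (Fin N × Fin N × Fin N)), p ∉ S →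
      0 ≤ Real.exp (-(κ * ((m + 2 : ℕ) : ℝ) * (momSq N p : ℝ) / (N : ℝ) ^ 2)) :=
    fun _ _ _ => (Real.exp_pos _).le
  have hsum : (S.card : ℝ) * Real.exp (-(3 * κ / 4)) ≤ bandSum κ N (m + 2) := by
    unfold bandSum
    calc (S.card : ℝ) * Real.exp (-(3 * κ / 4)) = ∑ _p ∈ S, Real.exp (-(3 * κ / 4)) := by
          rw [Finset.sum_const, nsmul_eq_mul]
      _ ≤ ∑ p ∈ S, Real.exp (-(κ * ((m + 2 : ℕ) : ℝ) * (momSq N p : ℝ) / (N : ℝ) ^ 2)) :=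
          Finset.sum_le_sum hterm
      _ ≤ ∑ p, Real.exp (-(κ * ((m + 2 : ℕ) : ℝ) * (momSq N p : ℝ) / (N : ℝ) ^ 2)) :=
          Finset.sum_le_sum_of_subset_of_nonneg (Finset.subset_univ S) hnonneg
  -- `√N ≤ s + 1`
  have hsqrt : Real.sqrt (N : ℝ) ≤ (s : ℝ) + 1 := by
    have h : ((N : ℕ) : ℝ) ≤ (((s + 1) ^ 2 : ℕ) : ℝ) := by exact_mod_cast hN1.le
    push_cast at h
    calc Real.sqrt (N : ℝ) ≤ Real.sqrt (((s : ℝ) + 1) ^ 2) := Real.sqrt_le_sqrt h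
      _ = (s : ℝ) + 1 := Real.sqrt_sq (by positivity)
  calc Real.exp (-(3 * κ / 4)) * Real.sqrt (N : ℝ) ^ 3
      ≤ Real.exp (-(3 * κ / 4)) * ((s : ℝ) + 1) ^ 3 := by gcongr
    _ = (S.card : ℝ) * Real.exp (-(3 * κ / 4)) := by rw [hcard]; push_cast; ring
    _ ≤ bandSum κ N (m + 2) := hsum

end Summit.QuantumFields.YangMills.Theorems.GlueballBandRecursion.Band

end
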